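import Summits.QuantumFields.BalabanUV.Beta.FP.KernelPeriodisationFib

/-!
# `BalabanUV.Beta.FP.KernelPeriodisationFibLoc` — road «FP» (binder row D1), RULING R-FP-51 row **(T-PER)**, PART 3: the DIAGONAL periodisation `dper M V` of LOCALISED
# insertion families (the design's `Per M`, HOME/CLAIMS.log [D1P3-G16-ROUTE-T]): `dper M V x y a b = Σ'_m V (x + M∘m) (y + M∘m) a b` is `Mℤ^{d+1}`-INVARIANT (so
# `KernelPeriodisationFib.perF_comp` applies to every word in resolvents and periodised insertions, all factors invariant) and, for a bi-localised `V`
# (`ExpKernelCalculus.BiLoc V p q C δ`), SUMMABLE and DECAYING at rate `δ∕2` with a constant UNIFORM IN THE PERIOD `M`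

Supplier: road-P3 lineage `b2b-balaban-gan24-p3` (gen 31).  NOT IN PRINT; OUR BOOKKEEPING ([folklore]).  One bookkeeping `def` (`dper`), no `Prop` minted, nothing cited.
CONTENT.  §1 `dper`, `dper_apply`, `dper_translate` (invariance; re-indexing, no convergence needed).  §2 for `BiLoc V p q C δ`, `0 < δ`, all `M_i ≥ 1`: the lattice sum
`Σ'_m e^{−a·|x + M∘m − p|₁} ≤ K_{d+1}(a)` uniformly in `x, M` (`B4Sect5Proof.latticeSum_le`, injectivity of `m ↦ x + M∘m`), `summable_dper`, **`decays_dper : Decays (dper M V)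
(C·e^{(δ∕2)|p−q|₁}·K_{d+1}(δ∕2)) (δ∕2)`** (the two localisation points of one copy are within `|x−y|₁ + |p−q|₁` of each other: `|x_m−p|₁ + |y_m−q|₁ ≥ |x−y|₁ − |p−q|₁`).  §3 the BIMODULE LAWS `comp_dper_left` ∕ `comp_dper_right` (an INVARIANT decaying
factor passes inside `dper`); §4 `comp_dper_apply_eq_tsum` ∕ `dper_comp_apply_eq_tsum` (a DECAYING, e.g. localised, factor: `X ∘ dper V′ = Σ'_j X ∘ V′(·+M∘j, ·+M∘j)` —
the period sum in the relative insertion point), `decays_of_biLoc`.  NOT HERE: the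
torus-trace identity for words with `dper` insertions (the design's «torus trace of a periodised localised word = the `Mℤ⁴`-periodisation of the ℤ⁴ word + wrap-around»; on the owner's GO).
Moves NO (CONV-C) clause and NO row-D1 binder; NOT SDF, NOT D1, NOT BetaPertH, NOT continuum, NOT Clay.  HONEST DEPENDENCY: continuum YM on T⁴ ⇐ BetaPertH ∧ nine spine estimates
(0/9 proved); BetaPertH ⇐ (D1) ∧ (D4) ∧ CAP+tail; G-an2-4 gates asym, D1 and NE2/3/4.
-/

noncomputable section

open scoped BigOperators
open Finset

namespace Summit.QuantumFields.BalabanUV.Beta.FP.KernelPeriodisationFibLoc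

open Literature.MathematicalPhysics.QuantumFieldTheory.Balaban1983to89
open Literature.MathematicalPhysics.QuantumFieldTheory.Balaban1983to89.Beta
open B12Sec2to5 (l1 l1_nonneg)
open B4TorusKernel.MultiPeriod (translate translate_apply translate_injective)
open B4Reflection242 (translate_translate)
open B4Sect5Proof (latticeConst latticeConst_nonneg latticeSum_le)
open ExpKernelCalculus (MKer Decays BiLoc shiftK l1_sub_triangle l1_sub_symm summable_exp_shift summable_exp_shift')
open Summit.QuantumFields.BalabanUV.Beta.GAN24.DirichletExhaustionDeltaZ (exp_l1_le_exp_dist)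
open Summit.QuantumFields.BalabanUV.Beta.GAN24.DirichletExhaustionPeriodise (one_le_M)
open Summit.QuantumFields.BalabanUV.Beta.FP.KernelPeriodisationFib (translate_eq_add)

variable {d : ℕ} {F : Type*}

/-! ## §1 The diagonal periodisation of a localised insertion -/

/-- **the DIAGONAL periodisation** of an insertion kernel: `dper M V x y a b = Σ'_m V (x + M∘m) (y + M∘m) a b` (sum over the translated copies). [our object] -/
def dper (M : Fin (d + 1) → ℕ) (V : MKer (d + 1) F) : MKer (d + 1) F :=
  fun x y a b => ∑' m : Fin (d + 1) → ℤ, V (translate M x m) (translate M y m) a b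

/-- unfolding `dper`. -/
theorem dper_apply (M : Fin (d + 1) → ℕ) (V : MKer (d + 1) F) (x y : Fin (d + 1) → ℤ) (a b : F) :
    dper M V x y a b = ∑' m : Fin (d + 1) → ℤ, V (translate M x m) (translate M y m) a b := rfl

/-- **`dper M V` is `Mℤ^{d+1}`-invariant** (re-indexing `m ↦ m₀ + m`; no convergence needed) — the `hBinv` binder of `perF_comp` for periodised insertions. -/
theorem dper_translate (M : Fin (d + 1) → ℕ) (V : MKer (d + 1) F) (m₀ x y : Fin (d + 1) → ℤ) (a b : F) :
    dper M V (translate M x m₀) (translate M y m₀) a b = dper M V x y a b := by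
  simp only [dper_apply, translate_translate]
  exact (Equiv.addLeft m₀).tsum_eq fun m => V (translate M x m) (translate M y m) a b

/-! ## §2 Summability and decay, uniformly in the period -/

section Decay

variable (M : Fin (d + 1) → ℕ) [∀ μ, NeZero (M μ)]

/-- finite partial sums of `e^{−a·dist(p, x + M∘m)}` over the period lattice are `≤ K_{d+1}(a)`, uniformly in `x`, `p`, `M` (distinct translates). -/
theorem sum_exp_dist_translate_le {a : ℝ} (ha : 0 < a) (p x : Fin (d + 1) → ℤ) (S : Finset (Fin (d + 1) → ℤ)) :
    ∑ m ∈ S, Real.exp (-(a * dist p (translate M x m))) ≤ latticeConst (d + 1) a := by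
  classical
  rw [← Finset.sum_image (f := fun z => Real.exp (-(a * dist p z)))
    (fun m _ m' _ h => translate_injective (one_le_M M) x h)]
  exact latticeSum_le (d + 1) ha _ p

/-- … hence the full lattice sum converges and is `≤ K_{d+1}(a)`. -/
theorem summable_exp_dist_translate {a : ℝ} (ha : 0 < a) (p x : Fin (d + 1) → ℤ) :
    Summable (fun m : Fin (d + 1) → ℤ => Real.exp (-(a * dist p (translate M x m)))) ∧
      ∑' m : Fin (d + 1) → ℤ, Real.exp (-(a * dist p (translate M x m))) ≤ latticeConst (d + 1) a := by
  have hs := summable_of_sum_le (fun m => (Real.exp_pos _).le) (sum_exp_dist_translate_le M ha p x)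
  exact ⟨hs, hs.tsum_le_of_sum_le (sum_exp_dist_translate_le M ha p x)⟩

/-- the `ℓ¹` version: `Σ'_m e^{−a·|x + M∘m − p|₁} ≤ K_{d+1}(a)`. -/
theorem summable_exp_l1_translate {a : ℝ} (ha : 0 < a) (p x : Fin (d + 1) → ℤ) :
    Summable (fun m : Fin (d + 1) → ℤ => Real.exp (-a * l1 (translate M x m - p))) ∧
      ∑' m : Fin (d + 1) → ℤ, Real.exp (-a * l1 (translate M x m - p)) ≤ latticeConst (d + 1) a := by
  obtain ⟨hs, hle⟩ := summable_exp_dist_translate M ha p x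
  have hterm : ∀ m : Fin (d + 1) → ℤ, Real.exp (-a * l1 (translate M x m - p)) ≤ Real.exp (-(a * dist p (translate M x m))) := fun m => by
    rw [dist_comm]; exact exp_l1_le_exp_dist ha.le _ _
  have hs' : Summable fun m : Fin (d + 1) → ℤ => Real.exp (-a * l1 (translate M x m - p)) :=
    hs.of_nonneg_of_le (fun m => (Real.exp_pos _).le) hterm
  exact ⟨hs', (hs'.tsum_le_tsum hterm hs).trans hle⟩

variable {V : MKer (d + 1) F} {p q : Fin (d + 1) → ℤ} {C δ : ℝ}

omit [∀ μ, NeZero (M μ)] in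
/-- the key geometric split for ONE translated copy: `e^{−δ(|x′−p|₁ + |y′−q|₁)} ≤ e^{(δ∕2)|p−q|₁}·e^{−(δ∕2)|x−y|₁}·e^{−(δ∕2)|x′−p|₁}` whenever `x′ − y′ = x − y`
(`|x′−p|₁ + |y′−q|₁ ≥ |x−y|₁ − |p−q|₁`). -/
theorem exp_biLoc_translate_le (hδ : 0 ≤ δ) (x y : Fin (d + 1) → ℤ) (m : Fin (d + 1) → ℤ) :
    Real.exp (-δ * (l1 (translate M x m - p) + l1 (translate M y m - q))) ≤
      Real.exp (δ / 2 * l1 (p - q)) * Real.exp (-(δ / 2) * l1 (x - y)) * Real.exp (-(δ / 2) * l1 (translate M x m - p)) := by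
  rw [← Real.exp_add, ← Real.exp_add, Real.exp_le_exp]
  have hxy : translate M x m - translate M y m = x - y := by
    rw [translate_eq_add, translate_eq_add]; abel
  have ht : l1 (x - y) ≤ l1 (translate M x m - p) + l1 (p - q) + l1 (translate M y m - q) := by
    rw [← hxy]
    calc l1 (translate M x m - translate M y m) ≤ l1 (translate M x m - q) + l1 (q - translate M y m) := l1_sub_triangle _ _ _
      _ ≤ (l1 (translate M x m - p) + l1 (p - q)) + l1 (q - translate M y m) := by
          gcongr; exact l1_sub_triangle _ _ _
      _ = _ := by rw [l1_sub_symm q]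
  have h1 := l1_nonneg (translate M x m - p)
  have h2 := l1_nonneg (translate M y m - q)
  nlinarith

omit [∀ μ, NeZero (M μ)] in
/-- termwise bound of the diagonal period sum of a bi-localised insertion. -/
theorem abs_dper_term_le (hV : BiLoc V p q C δ) (hC : 0 ≤ C) (hδ : 0 ≤ δ) (x y : Fin (d + 1) → ℤ) (a b : F) (m : Fin (d + 1) → ℤ) :
    |V (translate M x m) (translate M y m) a b| ≤
      C * Real.exp (δ / 2 * l1 (p - q)) * Real.exp (-(δ / 2) * l1 (x - y)) * Real.exp (-(δ / 2) * l1 (translate M x m - p)) := by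
  refine (hV _ _ a b).trans ?_
  rw [mul_assoc, mul_assoc]
  refine mul_le_mul_of_nonneg_left ?_ hC
  have := exp_biLoc_translate_le M (p := p) (q := q) hδ x y m
  simpa only [mul_assoc] using this

/-- **the diagonal period sum of a bi-localised insertion is summable.** -/
theorem summable_dper (hV : BiLoc V p q C δ) (hC : 0 ≤ C) (hδ : 0 < δ) (x y : Fin (d + 1) → ℤ) (a b : F) :
    Summable fun m : Fin (d + 1) → ℤ => V (translate M x m) (translate M y m) a b := by
  obtain ⟨hs, -⟩ := summable_exp_l1_translate M (half_pos hδ) p x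
  refine (hs.mul_left (C * Real.exp (δ / 2 * l1 (p - q)) * Real.exp (-(δ / 2) * l1 (x - y)))).of_norm_bounded fun m => ?_
  rw [Real.norm_eq_abs]
  have := abs_dper_term_le M hV hC hδ.le x y a b m
  simpa only [neg_div, mul_assoc] using this

/-- **`decays_dper` — THE PERIODISED INSERTION DECAYS, UNIFORMLY IN THE PERIOD**: `Decays (dper M V) (C·e^{(δ∕2)|p−q|₁}·K_{d+1}(δ∕2)) (δ∕2)`. [folklore] -/
theorem decays_dper (hV : BiLoc V p q C δ) (hC : 0 ≤ C) (hδ : 0 < δ) :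
    Decays (dper M V) (C * Real.exp (δ / 2 * l1 (p - q)) * latticeConst (d + 1) (δ / 2)) (δ / 2) := by
  intro x y a b
  obtain ⟨hs, hle⟩ := summable_exp_l1_translate M (half_pos hδ) p x
  set W := C * Real.exp (δ / 2 * l1 (p - q)) * Real.exp (-(δ / 2) * l1 (x - y)) with hW
  have hW0 : 0 ≤ W := by rw [hW]; positivity
  have hmaj := hs.mul_left W
  have hb := tsum_of_norm_bounded hmaj.hasSum fun m => by
    rw [Real.norm_eq_abs]
    have := abs_dper_term_le M hV hC hδ.le x y a b m
    simpa only [hW, neg_div, mul_assoc] using this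
  rw [Real.norm_eq_abs] at hb
  rw [dper_apply]
  refine hb.trans ?_
  rw [tsum_mul_left]
  calc W * ∑' m : Fin (d + 1) → ℤ, Real.exp (-(δ / 2) * l1 (translate M x m - p))
      ≤ W * latticeConst (d + 1) (δ / 2) := mul_le_mul_of_nonneg_left hle hW0
    _ = C * Real.exp (δ / 2 * l1 (p - q)) * latticeConst (d + 1) (δ / 2) * Real.exp (-(δ / 2) * l1 (x - y)) := by rw [hW]; ring

/-- the same with the localisation points equal (the road's vertex families `V μ y`, localised at `(N•y, N•y)`): constant `C·K_{d+1}(δ∕2)`. -/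
theorem decays_dper_diag {V : MKer (d + 1) F} {p : Fin (d + 1) → ℤ} (hV : BiLoc V p p C δ) (hC : 0 ≤ C) (hδ : 0 < δ) :
    Decays (dper M V) (C * latticeConst (d + 1) (δ / 2)) (δ / 2) := by
  have h := decays_dper M hV hC hδ
  simpa only [sub_self, l1, Pi.zero_apply, Int.cast_zero, abs_zero, Finset.sum_const_zero, mul_zero, Real.exp_zero, mul_one] using h

end Decay

/-! ## §3 `dper` is a bimodule map over the invariant kernels: `Y ∘ dper V = dper (Y ∘ V)`, `dper V ∘ Y = dper (V ∘ Y)` -/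

section Bimodule

variable [Fintype F] (M : Fin (d + 1) → ℕ) [∀ μ, NeZero (M μ)]
variable {Y V : MKer (d + 1) F} {CY γ C δ : ℝ} {p q : Fin (d + 1) → ℤ}

omit [∀ μ, NeZero (M μ)] in
/-- the translate by a fixed lattice vector is the right addition of `M∘k`. -/
theorem translate_eq_addRight (k y : Fin (d + 1) → ℤ) :
    translate M y k = Equiv.addRight (fun i => (M i : ℤ) * k i) y := by
  rw [Equiv.coe_addRight, translate_eq_add]

omit [∀ μ, NeZero (M μ)] in
/-- `e^{−δ(A + B)} ≤ e^{−δB}` for `A ≥ 0`, `δ ≥ 0` (dropping one localisation factor). -/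
theorem exp_neg_add_le_right {A B : ℝ} (hδ : 0 ≤ δ) (hA : 0 ≤ A) : Real.exp (-δ * (A + B)) ≤ Real.exp (-δ * B) :=
  Real.exp_le_exp.2 (by nlinarith)

omit [∀ μ, NeZero (M μ)] in
/-- … and `e^{−δ(A + B)} ≤ e^{−δA}` for `B ≥ 0`. -/
theorem exp_neg_add_le_left {A B : ℝ} (hδ : 0 ≤ δ) (hB : 0 ≤ B) : Real.exp (-δ * (A + B)) ≤ Real.exp (-δ * A) :=
  Real.exp_le_exp.2 (by nlinarith)

/-- the dominated double family behind `Y ∘ dper V` at `(x, z)`: `(k, y) ↦ Σ_f Y x y a f · V (y + M∘k) (z + M∘k) f b` is summable. -/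
theorem summable_comp_dper_left (hY : Decays Y CY γ) (hγ : 0 < γ) (hV : BiLoc V p q C δ) (hδ : 0 < δ) (hCY : 0 ≤ CY) (hC : 0 ≤ C)
    (x z : Fin (d + 1) → ℤ) (a b : F) :
    Summable (Function.uncurry fun (k y : Fin (d + 1) → ℤ) => ∑ f, Y x y a f * V (translate M y k) (translate M z k) f b) := by
  obtain ⟨hk, -⟩ := summable_exp_l1_translate M hδ q z
  have hmaj := ((hk.mul_of_nonneg (summable_exp_shift hγ x) (fun _ => (Real.exp_pos _).le) fun _ => (Real.exp_pos _).le).mul_left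
    ((Fintype.card F : ℝ) * (CY * C)))
  refine hmaj.of_norm_bounded fun yk => ?_
  obtain ⟨k, y⟩ := yk
  rw [Function.uncurry_apply_pair, Real.norm_eq_abs]
  calc |∑ f, Y x y a f * V (translate M y k) (translate M z k) f b| ≤ ∑ f, |Y x y a f * V (translate M y k) (translate M z k) f b| :=
        Finset.abs_sum_le_sum_abs _ _
    _ ≤ ∑ _f : F, CY * C * (Real.exp (-δ * l1 (translate M z k - q)) * Real.exp (-γ * l1 (x - y))) := by
        refine Finset.sum_le_sum fun f _ => ?_
        rw [abs_mul]
        calc |Y x y a f| * |V (translate M y k) (translate M z k) f b|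
            ≤ (CY * Real.exp (-γ * l1 (x - y))) * (C * Real.exp (-δ * l1 (translate M z k - q))) :=
              mul_le_mul (hY x y a f) ((hV _ _ f b).trans (mul_le_mul_of_nonneg_left (exp_neg_add_le_right hδ.le (l1_nonneg _)) hC))
                (abs_nonneg _) (by positivity)
          _ = CY * C * (Real.exp (-δ * l1 (translate M z k - q)) * Real.exp (-γ * l1 (x - y))) := by ring
    _ = (Fintype.card F : ℝ) * (CY * C) * (Real.exp (-δ * l1 (translate M z k - q)) * Real.exp (-γ * l1 (x - y))) := by
        rw [Finset.sum_const, Finset.card_univ, nsmul_eq_mul]; ring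

/-- **`Y ∘ dper V = dper (Y ∘ V)` for an INVARIANT decaying `Y` and a bi-localised `V`** — a word's invariant left factor passes inside the diagonal period sum. [folklore] -/
theorem comp_dper_left (hY : Decays Y CY γ) (hγ : 0 < γ)
    (hYinv : ∀ (m x y : Fin (d + 1) → ℤ) (a b : F), Y (translate M x m) (translate M y m) a b = Y x y a b)
    (hV : BiLoc V p q C δ) (hδ : 0 < δ) : ExpKernelCalculus.comp Y (dper M V) = dper M (ExpKernelCalculus.comp Y V) := by
  rcases isEmpty_or_nonempty F with hF | ⟨⟨f₀⟩⟩
  · funext x z a b; exact (IsEmpty.false a).elim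
  have hCY : 0 ≤ CY := hY.nonneg f₀
  have hC : 0 ≤ C := hV.nonneg f₀
  funext x z a b
  simp only [ExpKernelCalculus.comp, dper_apply]
  calc ∑' y, ∑ f, Y x y a f * ∑' k, V (translate M y k) (translate M z k) f b
      = ∑' y, ∑' k, ∑ f, Y x y a f * V (translate M y k) (translate M z k) f b := by
        refine tsum_congr fun y => ?_
        rw [Summable.tsum_finsetSum fun f _ => (summable_dper M hV hC hδ y z f b).mul_left _]
        exact Finset.sum_congr rfl fun f _ => tsum_mul_left.symm
    _ = ∑' k, ∑' y, ∑ f, Y x y a f * V (translate M y k) (translate M z k) f b :=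
        (summable_comp_dper_left M hY hγ hV hδ hCY hC x z a b).tsum_comm
    _ = ∑' k, ∑' y, ∑ f, Y (translate M x k) y a f * V y (translate M z k) f b := by
        refine tsum_congr fun k => ?_
        rw [← (Equiv.addRight (fun i => (M i : ℤ) * k i)).tsum_eq fun y => ∑ f, Y (translate M x k) y a f * V y (translate M z k) f b]
        refine tsum_congr fun y => ?_
        simp only [← translate_eq_addRight, hYinv]

/-- the dominated double family behind `dper V ∘ Y` at `(x, z)`. -/
theorem summable_comp_dper_right (hV : BiLoc V p q C δ) (hδ : 0 < δ) (hY : Decays Y CY γ) (hγ : 0 < γ) (hC : 0 ≤ C)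
    (x z : Fin (d + 1) → ℤ) (a b : F) :
    Summable (Function.uncurry fun (k y : Fin (d + 1) → ℤ) => ∑ f, V (translate M x k) (translate M y k) a f * Y y z f b) := by
  obtain ⟨hk, -⟩ := summable_exp_l1_translate M hδ p x
  have hmaj := ((hk.mul_of_nonneg (summable_exp_shift' hγ z) (fun _ => (Real.exp_pos _).le)
    fun _ => (Real.exp_pos _).le).mul_left ((Fintype.card F : ℝ) * (C * CY)))
  refine hmaj.of_norm_bounded fun yk => ?_
  obtain ⟨k, y⟩ := yk
  rw [Function.uncurry_apply_pair, Real.norm_eq_abs]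
  calc |∑ f, V (translate M x k) (translate M y k) a f * Y y z f b| ≤ ∑ f, |V (translate M x k) (translate M y k) a f * Y y z f b| :=
        Finset.abs_sum_le_sum_abs _ _
    _ ≤ ∑ _f : F, C * CY * (Real.exp (-δ * l1 (translate M x k - p)) * Real.exp (-γ * l1 (y - z))) := by
        refine Finset.sum_le_sum fun f _ => ?_
        rw [abs_mul]
        calc |V (translate M x k) (translate M y k) a f| * |Y y z f b|
            ≤ (C * Real.exp (-δ * l1 (translate M x k - p))) * (CY * Real.exp (-γ * l1 (y - z))) :=
              mul_le_mul ((hV _ _ a f).trans (mul_le_mul_of_nonneg_left (exp_neg_add_le_left hδ.le (l1_nonneg _)) hC)) (hY y z f b)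
                (abs_nonneg _) (by positivity)
          _ = C * CY * (Real.exp (-δ * l1 (translate M x k - p)) * Real.exp (-γ * l1 (y - z))) := by ring
    _ = (Fintype.card F : ℝ) * (C * CY) * (Real.exp (-δ * l1 (translate M x k - p)) * Real.exp (-γ * l1 (y - z))) := by
        rw [Finset.sum_const, Finset.card_univ, nsmul_eq_mul]; ring

/-- **`dper V ∘ Y = dper (V ∘ Y)` for an INVARIANT decaying `Y` and a bi-localised `V`.** [folklore] -/
theorem comp_dper_right (hV : BiLoc V p q C δ) (hδ : 0 < δ) (hY : Decays Y CY γ) (hγ : 0 < γ)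
    (hYinv : ∀ (m x y : Fin (d + 1) → ℤ) (a b : F), Y (translate M x m) (translate M y m) a b = Y x y a b) :
    ExpKernelCalculus.comp (dper M V) Y = dper M (ExpKernelCalculus.comp V Y) := by
  rcases isEmpty_or_nonempty F with hF | ⟨⟨f₀⟩⟩
  · funext x z a b; exact (IsEmpty.false a).elim
  have hC : 0 ≤ C := hV.nonneg f₀
  funext x z a b
  simp only [ExpKernelCalculus.comp, dper_apply]
  calc ∑' y, ∑ f, (∑' k, V (translate M x k) (translate M y k) a f) * Y y z f b
      = ∑' y, ∑' k, ∑ f, V (translate M x k) (translate M y k) a f * Y y z f b := by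
        refine tsum_congr fun y => ?_
        rw [Summable.tsum_finsetSum fun f _ => (summable_dper M hV hC hδ x y a f).mul_right _]
        exact Finset.sum_congr rfl fun f _ => tsum_mul_right.symm
    _ = ∑' k, ∑' y, ∑ f, V (translate M x k) (translate M y k) a f * Y y z f b :=
        (summable_comp_dper_right M hV hδ hY hγ hC x z a b).tsum_comm
    _ = ∑' k, ∑' y, ∑ f, V (translate M x k) y a f * Y y (translate M z k) f b := by
        refine tsum_congr fun k => ?_
        rw [← (Equiv.addRight (fun i => (M i : ℤ) * k i)).tsum_eq fun y => ∑ f, V (translate M x k) y a f * Y y (translate M z k) f b]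
        refine tsum_congr fun y => ?_
        simp only [← translate_eq_addRight, hYinv]

end Bimodule

/-! ## §4 A localised left factor: `X ∘ dper V′` as the period sum of the words with ONE translated copy of `V′` -/

section Expand

variable [Fintype F] (M : Fin (d + 1) → ℕ) [∀ μ, NeZero (M μ)]
variable {X V : MKer (d + 1) F} {CX δX C δ : ℝ} {pX qX p q : Fin (d + 1) → ℤ}

omit [Fintype F] [∀ μ, NeZero (M μ)] in
/-- a bi-localised kernel decays (constant `C·e^{δ|p−q|₁}`): `|x−p|₁ + |y−q|₁ ≥ |x−y|₁ − |p−q|₁`. -/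
theorem decays_of_biLoc (hX : BiLoc X p q C δ) (hC : 0 ≤ C) (hδ : 0 ≤ δ) : Decays X (C * Real.exp (δ * l1 (p - q))) δ := by
  intro x y a b
  refine (hX x y a b).trans ?_
  rw [mul_assoc, ← Real.exp_add]
  refine mul_le_mul_of_nonneg_left (Real.exp_le_exp.2 ?_) hC
  have h1 : l1 (x - y) ≤ l1 (x - p) + l1 (p - y) := l1_sub_triangle _ _ _
  have h2 : l1 (p - y) ≤ l1 (p - q) + l1 (q - y) := l1_sub_triangle _ _ _
  rw [l1_sub_symm q y] at h2
  nlinarith [l1_nonneg (x - p), l1_nonneg (y - q)]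

omit [Fintype F] [∀ μ, NeZero (M μ)] in
/-- the translated copy `V′(· + M∘j, · + M∘j)` is `shiftK (M∘j) V′`. -/
theorem shiftK_eq_translate (V : MKer (d + 1) F) (j x y : Fin (d + 1) → ℤ) (a b : F) :
    shiftK (fun i => (M i : ℤ) * j i) V x y a b = V (translate M x j) (translate M y j) a b := by
  simp only [shiftK, translate_eq_add]

/-- **`X ∘ dper V′ = Σ'_j X ∘ V′(· + M∘j, · + M∘j)`, entrywise**, for a DECAYING (e.g. bi-localised) `X` and a bi-localised `V′` — no invariance needed:
the ℤ^{d+1} word with a periodised insertion is the period sum, IN THE RELATIVE INSERTION POINT, of the words with one translated copy. [folklore] -/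
theorem comp_dper_apply_eq_tsum (hX : Decays X CX δX) (hδX : 0 < δX) (hV : BiLoc V p q C δ) (hδ : 0 < δ) (x z : Fin (d + 1) → ℤ) (a b : F) :
    ExpKernelCalculus.comp X (dper M V) x z a b =
      ∑' j : Fin (d + 1) → ℤ, ExpKernelCalculus.comp X (shiftK (fun i => (M i : ℤ) * j i) V) x z a b := by
  rcases isEmpty_or_nonempty F with hF | ⟨⟨f₀⟩⟩
  · exact (IsEmpty.false a).elim
  have hCX : 0 ≤ CX := hX.nonneg f₀
  have hC : 0 ≤ C := hV.nonneg f₀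
  simp only [ExpKernelCalculus.comp, dper_apply, shiftK_eq_translate]
  calc ∑' y, ∑ f, X x y a f * ∑' k, V (translate M y k) (translate M z k) f b
      = ∑' y, ∑' k, ∑ f, X x y a f * V (translate M y k) (translate M z k) f b := by
        refine tsum_congr fun y => ?_
        rw [Summable.tsum_finsetSum fun f _ => (summable_dper M hV hC hδ y z f b).mul_left _]
        exact Finset.sum_congr rfl fun f _ => tsum_mul_left.symm
    _ = ∑' k, ∑' y, ∑ f, X x y a f * V (translate M y k) (translate M z k) f b :=
        (summable_comp_dper_left M hX hδX hV hδ hCX hC x z a b).tsum_comm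

/-- … the same for a localised RIGHT factor: `dper V ∘ Y = Σ'_j V(·+M∘j, ·+M∘j) ∘ Y` entrywise, for a decaying `Y`. -/
theorem dper_comp_apply_eq_tsum (hV : BiLoc V p q C δ) (hδ : 0 < δ) (hX : Decays X CX δX) (hδX : 0 < δX) (x z : Fin (d + 1) → ℤ)
    (a b : F) :
    ExpKernelCalculus.comp (dper M V) X x z a b =
      ∑' j : Fin (d + 1) → ℤ, ExpKernelCalculus.comp (shiftK (fun i => (M i : ℤ) * j i) V) X x z a b := by
  rcases isEmpty_or_nonempty F with hF | ⟨⟨f₀⟩⟩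
  · exact (IsEmpty.false a).elim
  have hC : 0 ≤ C := hV.nonneg f₀
  simp only [ExpKernelCalculus.comp, dper_apply, shiftK_eq_translate]
  calc ∑' y, ∑ f, (∑' k, V (translate M x k) (translate M y k) a f) * X y z f b
      = ∑' y, ∑' k, ∑ f, V (translate M x k) (translate M y k) a f * X y z f b := by
        refine tsum_congr fun y => ?_
        rw [Summable.tsum_finsetSum fun f _ => (summable_dper M hV hC hδ x y a f).mul_right _]
        exact Finset.sum_congr rfl fun f _ => tsum_mul_right.symm
    _ = ∑' k, ∑' y, ∑ f, V (translate M x k) (translate M y k) a f * X y z f b :=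
        (summable_comp_dper_right M hV hδ hX hδX hC x z a b).tsum_comm

end Expand

end Summit.QuantumFields.BalabanUV.Beta.FP.KernelPeriodisationFibLoc

end
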